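import Summits.AnomalousDissipation.AnomalousDissipation.Theorems.MomentParityCubicParityLoudDiagonalClassificationBridge
import Summits.AnomalousDissipation.AnomalousDissipation.Theorems.CubicParityLoud.Negative.MeanFlow

/-!
# `stub_diagonalClassification`: translation-invariant quadratic Casimirs of ball-truncated Euler are `aE + bH`

Stub S3b of the line `farkas-split-menu` of crux `MomentParity.CubicParityLoud`
(`Summit.AnomalousDissipation.AnomalousDissipation.Theses.MomentParity.CubicParityLoud`), with
threshold `N₁ = 3`: beyond it, every block-diagonal kernel `D : ℤ³ → (ℂ³ →ₗ[ℂ] ℂ³)` whose real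
quadratic form `c ↦ Σ_{k∈S} Re⟪c k, D k (c k)⟫` (`S` the punctured frequency ball) is a Casimir of
the Galerkin–Euler field is, on admissible families, `a·Σ‖c k‖² + b·Σ Re⟪c k, 2πi k × c k⟫`
(Kraichnan 1973, asserted; here a theorem).  Proof: `bridge` classifies the effective real forms
(`β_k = α·id` on `k^⊥`, `γ_k = β·(k × ·)`); for an admissible `c` and `k ∈ S` write
`c k = u + i v` with real `u, v ⊥ k`; then
`2Re⟪c k, D k (c k)⟫ + 2Re⟪c(−k), D(−k) c(−k)⟫ = β_k(u,u) + β_k(v,v) + 2γ_k(v,u) = α‖c k‖² + (β/2π) Re⟪c k, curl⟫`,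
and summing over the symmetric ball (`k ↦ −k`) gives `4Q = αE + (β/2π)H`, i.e. `a = α/4`,
`b = β/(8π)`.
-/

namespace Summit.AnomalousDissipation.AnomalousDissipation.Theorems.MomentParityCubicParityLoud

open MeasureTheory Filter UnitAddTorus Complex Matrix
open scoped InnerProductSpace RealInnerProductSpace ENNReal ComplexConjugate
open Literature.Analysis.FunctionSpaces Literature.Analysis.FluidPDE
open Summit.AnomalousDissipation.AnomalousDissipation.Theses.MomentParity
open Summit.AnomalousDissipation.AnomalousDissipation.Theorems.CubicParityLoud.Negative

set_option linter.dupNamespace false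

/-- The helicity density of one Fourier mode in real coordinates: for `x = u + i v` (real
`u, v`), `Re⟪x, 2πi k × x⟫ = 4π v·(k × u)`. [folklore] -/
theorem re_inner_curlCoeff (c : (Fin 3 → ℤ) → EuclideanSpace ℂ (Fin 3)) (k : Fin 3 → ℤ) (u v : Fin 3 → ℝ)
    (hx : ∀ j, c k j = (u j : ℂ) + Complex.I * (v j : ℂ)) :
    (inner ℂ (c k) (IntermittentBeltrami.curlCoeff c k)).re =
      4 * Real.pi * (v ⬝ᵥ crossProduct (fun i => (k i : ℝ)) u) := by
  obtain ⟨h0, h1, h2⟩ := IntermittentBeltrami.cross_apply_fin (fun j => ((k j : ℤ) : ℂ)) (WithLp.ofLp (c k))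
  have e : ∀ j, WithLp.ofLp (c k) j = (u j : ℂ) + Complex.I * (v j : ℂ) := hx
  simp only [PiLp.inner_apply, RCLike.inner_apply, Fin.sum_univ_three, IntermittentBeltrami.curlCoeff_apply, 
    e, cross_apply, vec3_dotProduct, cons_val_zero, cons_val_one, cons_val_two, head_cons, tail_cons]
  simp only [map_mul, Complex.conj_ofReal, Complex.conj_I, Complex.add_re, Complex.sub_re,
        Complex.add_im, Complex.sub_im, Complex.mul_re, Complex.mul_im, Complex.neg_re, Complex.neg_im, Complex.ofReal_re,
        Complex.ofReal_im, Complex.I_re, Complex.I_im, Complex.re_ofNat, Complex.im_ofNat, 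
        mul_zero, zero_mul, sub_zero, zero_sub, add_zero, zero_add, mul_one, one_mul, neg_mul, mul_neg, neg_zero,
        map_add, Complex.conj_ofReal, Complex.ofReal_re, Complex.ofReal_im, Complex.intCast_re,
    Complex.intCast_im]
  ring

/-- The squared norm of one Fourier mode in real coordinates. [folklore] -/
theorem norm_sq_mode (x : EuclideanSpace ℂ (Fin 3)) (u v : Fin 3 → ℝ)
    (hx : ∀ j, x j = (u j : ℂ) + Complex.I * (v j : ℂ)) : ‖x‖ ^ 2 = u ⬝ᵥ u + v ⬝ᵥ v := by
  rw [EuclideanSpace.norm_eq, Real.sq_sqrt (Finset.sum_nonneg fun i _ => sq_nonneg _)]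
  simp only [Complex.sq_norm, Complex.normSq_apply, hx, Fin.sum_univ_three, vec3_dotProduct, Complex.add_re, 
        Complex.add_im, Complex.mul_re, Complex.mul_im, Complex.ofReal_re,
        Complex.ofReal_im, Complex.I_re, Complex.I_im, 
        mul_zero, zero_mul, sub_zero, add_zero, zero_add, one_mul
        ]
  ring

set_option maxHeartbeats 4000000 in
/-- **S3b `stub_diagonalClassification` — TRANSLATION-INVARIANT CASIMIRS ARE `span{E, H}`**
(Kraichnan 1973 JFM 59 §2, asserted; DHV 1985 p. 219; made a theorem here), threshold `N₁ = 3`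
(sharp: at `N = 2` the blocks at `(±2,0,0)` are not reached).  See the module docstring for the
proof. [cite: Kraichnan1973, §2] -/
theorem stub_diagonalClassification :
    ∃ N₁ : ℕ, ∀ N : ℕ, N₁ ≤ N → ∀ D : ((Fin 3 → ℤ) → (EuclideanSpace ℂ (Fin 3) →ₗ[ℂ] EuclideanSpace ℂ (Fin 3))),
      (∀ c : (Fin 3 → ℤ) → EuclideanSpace ℂ (Fin 3), (Torus.IsConjSymm c ∧ Torus.IsTransversal ((Torus.freqBall N).erase (0 : Fin 3 → ℤ)) c ∧
          ∀ k ∉ (Torus.freqBall N).erase (0 : Fin 3 → ℤ), c k = 0) →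
          ∑ k ∈ ((Torus.freqBall N).erase (0 : Fin 3 → ℤ)),
            ((inner ℂ (Torus.leraySym k (Torus.convectionCoeff ((Torus.freqBall N).erase (0 : Fin 3 → ℤ)) c c k)) (D k (c k))).re +
              (inner ℂ (c k) (D k (Torus.leraySym k (Torus.convectionCoeff ((Torus.freqBall N).erase (0 : Fin 3 → ℤ)) c c k)))).re) = 0) →
      ∃ a b : ℝ, ∀ c : (Fin 3 → ℤ) → EuclideanSpace ℂ (Fin 3), (Torus.IsConjSymm c ∧ Torus.IsTransversal ((Torus.freqBall N).erase (0 : Fin 3 → ℤ)) c ∧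
          ∀ k ∉ (Torus.freqBall N).erase (0 : Fin 3 → ℤ), c k = 0) →
        (∑ k ∈ ((Torus.freqBall N).erase (0 : Fin 3 → ℤ)), (inner ℂ (c k) (D k (c k))).re) =
          a * (∑ k ∈ ((Torus.freqBall N).erase (0 : Fin 3 → ℤ)), ‖c k‖ ^ 2) + b * (∑ k ∈ ((Torus.freqBall N).erase (0 : Fin 3 → ℤ)), (inner ℂ (c k) (IntermittentBeltrami.curlCoeff c k)).re) := by
  refine ⟨3, fun N hN D hD => ?_⟩
  obtain ⟨α, β, hbr⟩ := bridge N hN D hD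
  refine ⟨α / 4, β / (8 * Real.pi), fun c hc => ?_⟩
  obtain ⟨hcs, hct, hc0⟩ := hc
  set S : Finset (Fin 3 → ℤ) := (Torus.freqBall N).erase (0 : Fin 3 → ℤ) with hS_def
  have hSsym : ∀ k ∈ S, -k ∈ S := fun k hk => neg_mem_ballErase hk
  -- the per-frequency identity
  have perk : ∀ k ∈ S, 2 * Real.pi * (2 * (inner ℂ (c k) (D k (c k))).re + 2 * (inner ℂ (c (-k)) (D (-k) (c (-k)))).re) =
      2 * Real.pi * α * ‖c k‖ ^ 2 + β * (inner ℂ (c k) (IntermittentBeltrami.curlCoeff c k)).re := by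
    intro k hk
    obtain ⟨u, hu⟩ : ∃ u : Fin 3 → ℝ, u = fun j => (c k j).re := ⟨_, rfl⟩
    obtain ⟨v, hv⟩ : ∃ v : Fin 3 → ℝ, v = fun j => (c k j).im := ⟨_, rfl⟩
    have hxj : ∀ j, c k j = (u j : ℂ) + Complex.I * (v j : ℂ) := by
      intro j; rw [hu, hv, mul_comm]; exact (Complex.re_add_im _).symm
    have hx : c k = (WithLp.toLp 2 (fun i => ((u i : ℝ) : ℂ)) : EuclideanSpace ℂ (Fin 3)) + Complex.I • (WithLp.toLp 2 (fun i => ((v i : ℝ) : ℂ)) : EuclideanSpace ℂ (Fin 3)) := by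
      ext j; rw [PiLp.add_apply, PiLp.smul_apply, smul_eq_mul, cx_apply, cx_apply]; exact hxj j
    have hxbar : c (-k) = (WithLp.toLp 2 (fun i => ((u i : ℝ) : ℂ)) : EuclideanSpace ℂ (Fin 3)) - Complex.I • (WithLp.toLp 2 (fun i => ((v i : ℝ) : ℂ)) : EuclideanSpace ℂ (Fin 3)) := by
      rw [hcs k, hx, EuclideanSpace.conjVec_add, conjVec_cx, conjVec_I_smul_cx, neg_smul, sub_eq_add_neg]
    -- transversality of the real and imaginary parts
    have ht := hct k hk
    have huk : u ⬝ᵥ (fun i => (k i : ℝ)) = 0 := by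
      have := congrArg Complex.re ht
      simp only [Complex.re_sum, Complex.mul_re, Complex.intCast_re, Complex.intCast_im, zero_mul, sub_zero,
        Complex.zero_re] at this
      rw [hu, dotProduct]; simpa [mul_comm] using this
    have hvk : v ⬝ᵥ (fun i => (k i : ℝ)) = 0 := by
      have := congrArg Complex.im ht
      simp only [Complex.im_sum, Complex.mul_im, Complex.intCast_re, Complex.intCast_im, zero_mul, add_zero,
        Complex.zero_im] at this
      rw [hv, dotProduct]; simpa [mul_comm] using this
    have hPu : Torus.leraySym k (WithLp.toLp 2 (fun i => ((u i : ℝ) : ℂ)) : EuclideanSpace ℂ (Fin 3)) = (WithLp.toLp 2 (fun i => ((u i : ℝ) : ℂ)) : EuclideanSpace ℂ (Fin 3)) :=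
      Torus.leraySym_of_transversal (by rw [sum_intCast_mul_cx, huk]; simp)
    have hPv : Torus.leraySym k (WithLp.toLp 2 (fun i => ((v i : ℝ) : ℂ)) : EuclideanSpace ℂ (Fin 3)) = (WithLp.toLp 2 (fun i => ((v i : ℝ) : ℂ)) : EuclideanSpace ℂ (Fin 3)) :=
      Torus.leraySym_of_transversal (by rw [sum_intCast_mul_cx, hvk]; simp)
    -- the classified forms at `(u,u)`, `(v,v)`, `(v,u)`
    have hβu := (hbr k hk).1 u u huk
    have hβv := (hbr k hk).1 v v hvk
    have hγ := (hbr k hk).2 v u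
    rw [hPu] at hβu
    rw [hPv] at hβv
    rw [hPu, hPv] at hγ
    rw [norm_sq_mode (c k) u v hxj, re_inner_curlCoeff c k u v hxj, hx, hxbar]
    simp only [
        map_add, map_sub, map_smul, 
        inner_add_left, inner_add_right, inner_sub_left, inner_sub_right, inner_smul_left, inner_smul_right
        ] at hβu hβv hγ ⊢
    simp only [Complex.conj_I, Complex.add_re, Complex.sub_re,
        Complex.add_im, Complex.sub_im, Complex.mul_re, Complex.mul_im, Complex.neg_re, Complex.neg_im, 
        Complex.I_re, Complex.I_im, 
        zero_mul, zero_sub, zero_add, one_mul, neg_mul, neg_neg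
        ] at hβu hβv hγ ⊢
    linear_combination (2 * Real.pi) * hβu + (2 * Real.pi) * hβv + (4 * Real.pi) * hγ
  -- summation over the symmetric ball
  have hreidx : ∑ k ∈ S, (inner ℂ (c (-k)) (D (-k) (c (-k)))).re = ∑ k ∈ S, (inner ℂ (c k) (D k (c k))).re :=
    Finset.sum_nbij' (fun k => -k) (fun k => -k) (fun k hk => hSsym k hk) (fun k hk => hSsym k hk)
      (fun k _ => neg_neg k) (fun k _ => neg_neg k) (fun k _ => rfl)
  have hsum := Finset.sum_congr rfl perk
  rw [← Finset.mul_sum, Finset.sum_add_distrib, Finset.sum_add_distrib, ← Finset.mul_sum, ← Finset.mul_sum,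
    ← Finset.mul_sum, ← Finset.mul_sum, hreidx] at hsum
  have hπ : Real.pi ≠ 0 := Real.pi_ne_zero
  field_simp
  linear_combination 4 * hsum

end Summit.AnomalousDissipation.AnomalousDissipation.Theorems.MomentParityCubicParityLoud
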